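import Mathlib.Analysis.Normed.Ring.InfiniteSum
import Mathlib.NumberTheory.ModularForms.JacobiTheta.Bounds
import HarnessLib

/-!
# Crux `BirComplexStableXYR`, line `fat-gaussian-defect-calculus`: stub A2 `stub_spatialThetaSummable`

Registered stub (lead c8, wave 11, skeleton `Cruxes/BirComplexStableXYR/Lines/fat_gaussian_defect_calculus.lean`),
helper (`--supports`) for the crux `Summit.HubbardSuperconductivity.HubbardSuperconductivity.Theses.BalabanIR.BirComplexStableXYR`:
**a coercive spatial theta series is summable and positive.**

**Statement.** If `f : ℤ × ℤ → ℝ` satisfies `κ (h₀² + h₁²) ≤ f h` for all `h`, with `κ > 0`, then the double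
series `Σ_{h ∈ ℤ²} exp(−f h)` is summable and its sum is positive.  (With the coercivity A1 of the spatial
holonomy form this is the spatial factor of the Gaussian vortex-free sum.)

**Proof.** Pure Mathlib.  Termwise `0 ≤ exp(−f h) ≤ exp(−κ h₀²) · exp(−κ h₁²)` (`Real.exp_add`,
`Real.exp_le_exp`, the hypothesis).  The one-dimensional integer Gaussian `Σ_{n ∈ ℤ} exp(−κ n²)` is summable
(`HurwitzKernelBounds.summable_f_int` with `k = 0`, no shift, `t = κ/π`) and nonnegative, so the product family
on `ℤ × ℤ` is summable (`Summable.mul_of_nonneg`), hence so is the dominated family (`Summable.of_nonneg_of_le`).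
Positivity: all terms are positive and the family is summable (`Summable.tsum_pos` at the index `(0, 0)`).
Elementary given Mathlib; no definition and no named fact is introduced; sorry-free. [folklore]
-/

set_option linter.dupNamespace false -- `Summit.<S>.<S>.Theorems…` repeats the summit name (D-0017 layout)

namespace Summit.HubbardSuperconductivity.HubbardSuperconductivity.Theorems.FSUnfolding

open Real

/-- **One-dimensional integer Gaussian is summable:** `Σ_{n ∈ ℤ} exp(−κ n²) < ∞` for `κ > 0`
(Mathlib's `HurwitzKernelBounds.summable_f_int` with `k = 0`, shift `0`, `t = κ/π`). [folklore] -/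
theorem hsc_spTheta_gauss_summable (κ : ℝ) (hκ : 0 < κ) :
    Summable (fun n : ℤ => Real.exp (-(κ * (n : ℝ) ^ 2))) := by
  have := HurwitzKernelBounds.summable_f_int 0 0 (by positivity : 0 < κ / π)
  refine this.congr (fun n => ?_)
  simp only [HurwitzKernelBounds.f_int, pow_zero, one_mul, add_zero]
  congr 1
  field_simp

/-- **Product of two integer Gaussians is summable on `ℤ × ℤ`:** the family
`h ↦ exp(−κ h₀²) · exp(−κ h₁²)` is summable for `κ > 0` (`Summable.mul_of_nonneg`). [folklore] -/
theorem hsc_spTheta_prod_summable (κ : ℝ) (hκ : 0 < κ) :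
    Summable (fun h : ℤ × ℤ =>
      Real.exp (-(κ * (h.1 : ℝ) ^ 2)) * Real.exp (-(κ * (h.2 : ℝ) ^ 2))) :=
  (hsc_spTheta_gauss_summable κ hκ).mul_of_nonneg (hsc_spTheta_gauss_summable κ hκ)
    (fun _ => (Real.exp_pos _).le) (fun _ => (Real.exp_pos _).le)

/-- **stub A2 (S/M, generic): a coercive spatial theta series is summable and positive.**  If `f(h) ≥ κ(h₀² + h₁²)` with
`κ > 0` then `Σ_{h∈ℤ²} e^{−f(h)}` converges to a positive real (domination by a product of two one-dimensional Gaussian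
series).  With A1 (`Q_sp ≥ c₀(x² + y²)`) this is the spatial factor of the Gaussian vortex-free sum. [folklore] -/
theorem stub_spatialThetaSummable :
    ∀ (f : ℤ × ℤ → ℝ) (κ : ℝ), 0 < κ → (∀ h : ℤ × ℤ, κ * (((h.1 : ℝ)) ^ 2 + ((h.2 : ℝ)) ^ 2) ≤ f h) →
      Summable (fun h : ℤ × ℤ => Real.exp (-f h)) ∧ 0 < ∑' h : ℤ × ℤ, Real.exp (-f h) := by
  intro f κ hκ hf
  have hsum : Summable (fun h : ℤ × ℤ => Real.exp (-f h)) := by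
    refine Summable.of_nonneg_of_le (fun _ => (Real.exp_pos _).le) (fun h => ?_)
      (hsc_spTheta_prod_summable κ hκ)
    rw [← Real.exp_add]
    exact Real.exp_le_exp.mpr (by linarith [hf h])
  exact ⟨hsum, hsum.tsum_pos (fun _ => (Real.exp_pos _).le) (0, 0) (Real.exp_pos _)⟩

end Summit.HubbardSuperconductivity.HubbardSuperconductivity.Theorems.FSUnfolding
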